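import Summits.AtomisticToContinuum.Crystallization.Theorems.FrustratedLawDichotomyStrainedPatchGaugeCells

/-!
(SPLIT FOR THE 400-LINE CAP by the landing lane, hand-2 g30: this file = part A; part B = `…FrustratedLawDichotomyStrainedPatchShellWitness` imports it; same namespace, all FQNs unchanged.)
# SHELL WITNESSES: the distance-level DEAD-CELL certificates of the 27623 cell census, typed and proved (decomp-a2c lens-5 g64)

Target of record (61H, tree `…StrainedPatchHostCells`): `[CORE-FAR] = CoreOffTubeFloor (63/10) (63/10) (24/5) (1/100) 0 ⟸ TubeP ∧ CoverP`, gauge-fixed by 63G to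
`TubeFloor (FamG WSym) (1/80) ∧ CoverP`; 62B's cells read `ExactCert := ∀ k G ξ b, … → FatTubeFloor (bendAt b (N.ref k G ξ)) (N.c k) (1/80) 0 0` (EXACT riding, pair tolerance
`2τ = 1/40`).  63G §3 typed the census's one-site infeasibility certificates `LooseWitness` / `TightWitness` (⟹ `DeadRef` ⟹ (FT) vacuously) as CLUSTER-level universal
statements; what a census can evaluate is REFERENCE-level distance data.  This node supplies exactly those bridges (critic row 1098, lens-5 task #0 «TYPE (K13) +
`tightWitness_of_…` / `looseWitness_of_…` and the (R12) count analogue»), at exact riding `(τ, 0, 0)` = the 62B interface.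

## THE NODE (every junction PROVED, 0 sorry; imports ONLY the tree)

**§0** the 63G §3 decls this node stands on (`Charted`, `DeadRef`, (T1)–(T3), `LooseWitness`, `TightWitness`, their DEAD junctions), VERBATIM (63G is critic-cleared but
HOME-only; delete §0 on landing).  **§1** the chart toolkit at exact riding: `Charted.dev` (EVERY pair distance among `63/10`-ball cluster sites is within `2τ` of the
distance of their reference labels), `Charted.cover` / `.inj` / `.centre`.

**§2 DEAD-hi, PROVED LEAF-FREE.**  `fit_sites`: what `FitAtScale P (1/8) (3/2) z a` forces at the distance level (12 DISTINCT sites `≠ a` at distances in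
`[d, (1+η) d]`, `η < 1/8`, `d ≤` the least distance from `a`, one site AT distance `≤ d`, the `13/10·d` gap populated by shell sites only).  Two labelling-free
certificates, each ⟹ `LooseWitness z₁ c₁ τ 0 0 a₁` ⟹ `DeadRef`:  ★ (R12) `looseWitness_of_fewNear` — FEWER THAN TWELVE reference sites other than `a₁` lie within
`9/8·(ρ₁ + 2τ) + 2τ` of `a₁`, `ρ₁` the distance from `a₁` to any one reference site `s₁ ≠ a₁` of the `6`-ball (a good cluster fit at `a` would put 12 cluster sites within
`(1+η) d < 9/8·(ρ₁ + 2τ)` of `a`, all inside the `63/10`-ball by ROOM, hence 12 reference labels within that radius `+ 2τ`: `no_fit_of_fewNear`);  ★ (N13)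
`looseWitness_of_crowd` — MORE THAN TWELVE reference sites lie within `R` of `a₁` with `R + 2τ < 13/10·(m₁ − 2τ)`, `m₁` a lower bound for all distances from `a₁`
(the crowd is contained in the chart image of the 12-point cluster shell, since the `13/10·d`-window holds shell sites only: `no_fit_of_crowd`, `Finset.card_le_card` + `card_image_le`).

**§3 DEAD-lo = ONE ANALYTIC LEAF + A PROVED BRIDGE.**  Leaves: (K13-inst) `ShellFit P p p₀ ε θ` — every 13-point configuration whose `12 + 66` mutual distances are
within `ε` of those of the reference shell `(p₀; p)` carries an isometric `P`-fit at ITS pinned scale with misfit `≤ θ`, same labelling (`A'` over ALL linear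
isometries: mirror-safe) — a closed semialgebraic condition on 13 reference points, certifiable per cell; (K13) `ShellRigid13At c P` / `ShellRigid13 c` — the
UNIFORM version: a shell with a misfit-`η d` fit (`η ≤ 1/8`) and data error `ε ≤ d/20` has `ShellFit … ε (η d + c ε)`; classical, the CONSTANT `c` is the whole
content (uncalibrated here — census job).  ★★ `fit_twentieth_of_shellFit` (THE TIGHT BRIDGE, PROVED): reference shell `S` pinned at `d₁` with a clean gap of half-width
`g₁` about `13/10·d₁` + the instance leaf at `ε = 2τ` + margins (M1) `20 θ < d₁ − 2τ`, (M2) `23τ/5 < g₁`, (M3) `d₁ + 2τ ≤ 3/2`, (M4) room, (M5) `40τ ≤ d₁` ⟹ every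
cluster site charted onto `a₁` is `FitAtScale P (1/20) (3/2)` (shell = chart preimages of `S`, labelled BY the chart — no `12!`; scale re-pinned in the whole
cluster and gap transferred through `Charted.dev` / `.inj`).  Hence `tightWitness_of_{fcc,hcp}ShellFit`, `deadRef_of_{fcc,hcp}ShellFit` (instance leaf) and
`fit_twentieth_of_refShell`, `tightWitness_of_{fcc,hcp}Shell`, `deadRef_of_{fcc,hcp}Shell` (uniform leaf, (M1) reading `20·(η₁ d₁ + 2cτ) < d₁ − 2τ`).

**§4 THE WALLS AT `τ = 1/80`, EXACT.**  `tight_margin_record_iff`: (M1) ⟺ `c < 2 d₁ (1 − 20 η₁) − 1/20` — the kill criterion of record («c₁₃ ≥ 2 ⇒ no dead-lo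
wall») made exact and scale-aware (`d₁ = 1, η₁ = 0`: `c < 39/20`); `loose_radius_record`: the (R12) radius is `9/8·ρ₁ + 17/320`.  (Memo §2, not formalised: the
explicit mode «one shell point in by `ε`, eleven out by `ε/2`» at the perfect shell obeys all 78 data bounds and forces pinned misfit `≥ 3ε/2`, so every valid `c` is
`≥ 3/2` and the dead-lo wall is THIN — reference misfit `η₁ < (2 d₁ − 1/20 − c)/(40 d₁) ≤ 1.1 %` at `d₁ = 1` — whatever the calibration; the finite range of lens-5 is
bounded by the PROVED dead-hi certificates (R12)/(N13) and the live annulus.)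

PIECES AND TAGS.  `DeadRef z₁ c₁ τ 0 0` [one cell of 62B's `ExactCert`, decided VACUOUSLY] ⟸ (R12) ∨ (N13) [COMBINATORIAL counts on reference distances ·
PROVED · leaf-free · INSTRUMENTABLE ← census evaluates two radii per site]  ∨  ((K13-inst) at the site [ANALYTIC, 13 points · UNDECIDED per cell · INSTRUMENTABLE
← validated Procrustes/Krawczyk per cell] ∧ margins (M1)–(M5) [ARITHMETIC on census data · PROVED bridge]),  (K13-inst) ⟸ (K13) `ShellRigid13 c` [ANALYTIC ·
classical modulo the constant · UNDECIDED · ATTACKABLE (trilateration + re-fit) · INSTRUMENTABLE (one 13-point linearised SVD bounds `c` below; census)].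
WHY EACH PIECE IS STRICTLY WEAKER than the target: every certificate decides (FT) at ONE reference and only in the vacuous direction; (R12)/(N13) are finite
counting statements about one reference configuration; (K13) speaks of 13-point configurations in `E3` and of nothing in the census, HR39 or admissibility.
WHY NOVEL (w.r.t. 63G and the tree): the tree's shell rigidity (`TwoShellRigidity`, `CoarseCappedRigidity`, KR18 `3.95 θ`) is LINK-WINDOW rigidity in position
currency and loses `4τ` — no inner wall at `τ = 1/80` (63 dead end); here the currency is the COMPLETE distance data of the charted 13-clique, the labelling is
induced by the chart, and two of the three walls need no rigidity at all.  Nothing is COSTUME: no decl restates (FT), `TubeP` or a refuted statement; the leaf is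
named, isolated and carries its exact margin.  KILL: `c ≥ 2 d₁ (1 − 20 η₁) − 1/20` at every census shell AND (K13-inst) uncertifiable per cell ⇒ dead-lo cells join
the live count (the node degrades, it does not die); (R12)/(N13) cannot be killed (proved).  Tree-only imports; no `sorry`; no new axioms; no instances / notation.
-/

noncomputable section

namespace Summit.AtomisticToContinuum.Crystallization.Theorems.FrustratedLawDichotomyStrainedPatchShellWitness

open scoped BigOperators Classical RealInnerProductSpace
open Literature.Geometry.DiscreteGeometry (fccKissingPattern hcpKissingPattern card_fccKissingPattern card_hcpKissingPattern
  norm_eq_one_of_mem_fccKissingPattern norm_eq_one_of_mem_hcpKissingPattern one_le_dist_of_mem_fccKissingPattern one_le_dist_of_mem_hcpKissingPattern)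
open Summit.AtomisticToContinuum.Crystallization.Theorems.FrustratedLawDichotomyPeriodicBlockFlags (goodAtScale_mono)
open Summit.AtomisticToContinuum.Crystallization.Theorems.FrustratedLawDichotomyRangeCut (Sep)
open Summit.AtomisticToContinuum.Crystallization.Theorems.FrustratedLawDichotomyMotifLemmas
open Summit.AtomisticToContinuum.Crystallization.Theorems.FrustratedLawDichotomyAveragingCut
open Summit.AtomisticToContinuum.Crystallization.Theorems.FrustratedLawDichotomyAveragingRuleCap
open Summit.AtomisticToContinuum.Crystallization.Theorems.FrustratedLawDichotomyAveragingRuleTightFree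
open Summit.AtomisticToContinuum.Crystallization.Theorems.FrustratedLawDichotomyExemptDoor (SitePred)
open Summit.AtomisticToContinuum.Crystallization.Theorems.FrustratedLawDichotomyExemptAbsorption
open Summit.AtomisticToContinuum.Crystallization.Theorems.FrustratedLawDichotomyExemptAbsorptionRecord
open Summit.AtomisticToContinuum.Crystallization.Theorems.FrustratedLawDichotomyCollarCensus
open Summit.AtomisticToContinuum.Crystallization.Theorems.FrustratedLawDichotomyCollarCensusKappa
open Summit.AtomisticToContinuum.Crystallization.Theorems.FrustratedLawDichotomyStrainedPatchHomSplit
open Summit.AtomisticToContinuum.Crystallization.Theorems.FrustratedLawDichotomyStrainedPatchCleanCollar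
open Summit.AtomisticToContinuum.Crystallization.Theorems.FrustratedLawDichotomyStrainedPatchHomTube
open Summit.AtomisticToContinuum.Crystallization.Theorems.FrustratedLawDichotomyStrainedPatchHomPolar
open Summit.AtomisticToContinuum.Crystallization.Theorems.FrustratedLawDichotomyStrainedPatchHomIsometry
open Summit.AtomisticToContinuum.Crystallization.Theorems.FrustratedLawDichotomyStrainedPatchHomTubeIso
open Summit.AtomisticToContinuum.Crystallization.Theorems.FrustratedLawDichotomyStrainedPatchPhaseCut
open Summit.AtomisticToContinuum.Crystallization.Theorems.FrustratedLawDichotomyStrainedPatchCoreTube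
open Summit.AtomisticToContinuum.Crystallization.Theorems.FrustratedLawDichotomyStrainedPatchCoreTubeRecord
open Summit.AtomisticToContinuum.Crystallization.Theorems.FrustratedLawDichotomyStrainedPatchCoreTubeMilli
open Summit.AtomisticToContinuum.Crystallization.Theorems.FrustratedLawDichotomyStrainedPatchStrainBands
open Summit.AtomisticToContinuum.Crystallization.Theorems.FrustratedLawDichotomyStrainedPatchChartFamilies
open Summit.AtomisticToContinuum.Crystallization.Theorems.FrustratedLawDichotomyStrainedPatchChartFamiliesBent
open Summit.AtomisticToContinuum.Crystallization.Theorems.FrustratedLawDichotomyStrainedPatchChartFamiliesPinned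
open Summit.AtomisticToContinuum.Crystallization.Theorems.FrustratedLawDichotomyStrainedPatchRecutPairs
open Summit.AtomisticToContinuum.Crystallization.Theorems.FrustratedLawDichotomyStrainedPatchRecutKinematics
open Summit.AtomisticToContinuum.Crystallization.Theorems.FrustratedLawDichotomyStrainedPatchWindowFamilies
open Summit.AtomisticToContinuum.Crystallization.Theorems.FrustratedLawDichotomyStrainedPatchHostCells
open Summit.AtomisticToContinuum.Crystallization.Theorems.FrustratedLawDichotomyStrainedPatchGaugeCells

/-! §0 of the seat file (11 declarations `Charted … room_record`, verbatim from 63G §3) was DELETED on landing (critic rows 1106 (c) / 1110):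
63G `…StrainedPatchGaugeCells` is in the tree and is imported + opened instead — same names, same text.  Consequently the §1
projection lemmas `Charted.dev/.inj/.injective/.good/.cover/.centre` are declared INTO the namespace of `Charted`
(`…StrainedPatchGaugeCells.Charted.*`, via `_root_`), so that the dot-notation `hch.dev` of the seat file keeps working. -/

/-! ## §1. The exact-riding chart toolkit `(τ, 0, 0)` (62B's `ExactCert` interface: pair tolerance `2τ`, no strain / curvature allowance) -/

section Chart
variable {M₁ : ℕ} {z₁ : Fin M₁ → E3} {c₁ : Fin M₁} {τ : ℝ} {M : ℕ} {z : Fin M → E3} {c : Fin M} {e' : Fin M → Fin M₁}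

/-- The charted cluster is injective (admissibility). [formal bookkeeping] -/
theorem _root_.Summit.AtomisticToContinuum.Crystallization.Theorems.FrustratedLawDichotomyStrainedPatchGaugeCells.Charted.injective {κ lam : ℝ} (h : Charted z₁ c₁ τ κ lam M z c e') : Function.Injective z := h.1.1

/-- The charted cluster is `1/8`-clean on the `63/10`-ball. [formal bookkeeping] -/
theorem _root_.Summit.AtomisticToContinuum.Crystallization.Theorems.FrustratedLawDichotomyStrainedPatchGaugeCells.Charted.good {κ lam : ℝ} (h : Charted z₁ c₁ τ κ lam M z c e') {a : Fin M} (ha : dist (z a) (z c) ≤ 63 / 10) : GoodAtScale (1 / 8) (3 / 2) z a :=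
  h.2.1 a ha

/-- The chart is injective on the `63/10`-ball. [formal bookkeeping] -/
theorem _root_.Summit.AtomisticToContinuum.Crystallization.Theorems.FrustratedLawDichotomyStrainedPatchGaugeCells.Charted.inj {κ lam : ℝ} (h : Charted z₁ c₁ τ κ lam M z c e') {a b : Fin M} (ha : dist (z a) (z c) ≤ 63 / 10) (hb : dist (z b) (z c) ≤ 63 / 10)
    (he : e' a = e' b) : a = b :=
  h.2.2.2.2.2.1 a b ha hb he

/-- The chart covers the reference `6`-ball by ball sites. [formal bookkeeping] -/
theorem _root_.Summit.AtomisticToContinuum.Crystallization.Theorems.FrustratedLawDichotomyStrainedPatchGaugeCells.Charted.cover {κ lam : ℝ} (h : Charted z₁ c₁ τ κ lam M z c e') {b₁ : Fin M₁} (hb₁ : dist (z₁ b₁) (z₁ c₁) ≤ 6) :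
    ∃ a, dist (z a) (z c) ≤ 63 / 10 ∧ e' a = b₁ :=
  h.2.2.2.2.2.2 b₁ hb₁

/-- ★ EXACT RIDING: pair distances inside the `63/10`-ball are read off the reference up to `2τ`. [formal bookkeeping] -/
theorem _root_.Summit.AtomisticToContinuum.Crystallization.Theorems.FrustratedLawDichotomyStrainedPatchGaugeCells.Charted.dev (h : Charted z₁ c₁ τ 0 0 M z c e') {a b : Fin M} (ha : dist (z a) (z c) ≤ 63 / 10) (hb : dist (z b) (z c) ≤ 63 / 10) :
    |dist (z a) (z b) - dist (z₁ (e' a)) (z₁ (e' b))| ≤ 2 * τ := by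
  have h₁ := h.2.2.2.2.1 a b ha hb
  simpa only [zero_mul, add_zero] using h₁

/-- (T3) at exact riding: a ball site lies within `dist (z₁ (e' a)) (z₁ c₁) + 2τ` of the centre. [formal bookkeeping] -/
theorem _root_.Summit.AtomisticToContinuum.Crystallization.Theorems.FrustratedLawDichotomyStrainedPatchGaugeCells.Charted.centre (h : Charted z₁ c₁ τ 0 0 M z c e') {a : Fin M} (ha : dist (z a) (z c) ≤ 63 / 10) :
    dist (z a) (z c) ≤ dist (z₁ (e' a)) (z₁ c₁) + 2 * τ := by
  have h₁ := charted_dist_centre_le h ha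
  simpa only [zero_mul, add_zero] using h₁

end Chart

/-! ## §2. The first shell of a good site, read through the chart: the LEAF-FREE loose bridges (R12) and (N13) -/

/-- ★ **SHELL EXTRACTION** (generic in the kissing pattern `P : ι → E3`, unit vectors pairwise `≥ 1` apart): a pattern fit `FitAtScale P ηm D y i` with
`ηm ≤ 1/2` in an injective cluster yields twelve (`= card ι`) DISTINCT cluster sites `k u ≠ i` with `d ≤ dist ≤ (1+η) d` from `y i` (`d` = the nn distance,
`d ≤ D`, `η < ηm`), pattern-comparable mutual distances `|dist (y (k u)) (y (k v)) − d·dist (P u) (P v)| ≤ 2ηd`, the nn pinning, and the CLEAN GAP: every other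
site closer than `13/10·d` is one of the `k u`. [folklore] -/
theorem fit_sites {ι : Type*} (P : ι → E3) (hP1 : ∀ u, ‖P u‖ = 1) (hPsep : ∀ u v, u ≠ v → 1 ≤ dist (P u) (P v))
    {ηm D : ℝ} (hηm : ηm ≤ 1 / 2) {N : ℕ} {y : Fin N → E3} (hy : Function.Injective y) {i : Fin N} (h : FitAtScale P ηm D y i) :
    ∃ (d η : ℝ) (k : ι → Fin N), 0 < d ∧ d ≤ D ∧ η < ηm ∧ Function.Injective k ∧ (∀ u, k u ≠ i) ∧
      (∀ u, d ≤ dist (y (k u)) (y i) ∧ dist (y (k u)) (y i) ≤ (1 + η) * d) ∧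
      (∀ u v, |dist (y (k u)) (y (k v)) - d * dist (P u) (P v)| ≤ 2 * η * d) ∧
      (∀ j, j ≠ i → d ≤ dist (y j) (y i)) ∧ (∃ j, j ≠ i ∧ dist (y j) (y i) ≤ d) ∧
      (∀ j, j ≠ i → dist (y j) (y i) < 13 / 10 * d → ∃ u, k u = j) := by
  obtain ⟨d, η, γ, A, hdD, t, hd, hγ, hη, hT, hpin, hpin', hgap⟩ := h
  choose k hk using fun u => (hT u).1
  have hfit : ∀ u, ‖(y (k u) - y i) - d • A (P u)‖ ≤ η * d := fun u => by rw [hk u]; exact (hT u).2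
  have hnd : ∀ u, ‖d • A (P u)‖ = d := fun u => by
    rw [norm_smul, LinearIsometry.norm_map, hP1, mul_one, Real.norm_of_nonneg hd.le]
  have hsub : ∀ u v, ‖d • A (P u) - d • A (P v)‖ = d * dist (P u) (P v) := fun u v => by
    rw [← smul_sub, ← map_sub, norm_smul, LinearIsometry.norm_map, Real.norm_of_nonneg hd.le, dist_eq_norm]
  have hpi : ∀ j, j ≠ i → d ≤ dist (y j) (y i) := fun j hj => hpin (y j) ⟨j, rfl⟩ (hy.ne hj)
  have hki : ∀ u, k u ≠ i := by
    intro u hu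
    have h₁ := hfit u
    rw [hu, sub_self, zero_sub, norm_neg, hnd] at h₁
    nlinarith [mul_lt_mul_of_pos_right (show η < 1 / 2 by linarith) hd]
  have hkinj : Function.Injective k := by
    intro u v huv
    by_contra hne
    have hsep := hPsep u v hne
    have h₂ : d • A (P u) - d • A (P v) = ((y (k v) - y i) - d • A (P v)) - ((y (k u) - y i) - d • A (P u)) := by
      rw [huv]; abel
    have h₃ : ‖d • A (P u) - d • A (P v)‖ ≤ η * d + η * d := by
      rw [h₂]; exact (norm_sub_le _ _).trans (add_le_add (hfit v) (hfit u))
    rw [hsub] at h₃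
    nlinarith [mul_le_mul_of_nonneg_left hsep hd.le, mul_lt_mul_of_pos_right (show η < 1 / 2 by linarith) hd]
  have hdist : ∀ u, d ≤ dist (y (k u)) (y i) ∧ dist (y (k u)) (y i) ≤ (1 + η) * d := by
    intro u
    refine ⟨hpi (k u) (hki u), ?_⟩
    rw [dist_eq_norm]
    calc ‖y (k u) - y i‖ = ‖((y (k u) - y i) - d • A (P u)) + d • A (P u)‖ := by rw [sub_add_cancel]
      _ ≤ ‖(y (k u) - y i) - d • A (P u)‖ + ‖d • A (P u)‖ := norm_add_le _ _
      _ ≤ η * d + d := add_le_add (hfit u) (hnd u).le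
      _ = (1 + η) * d := by ring
  have hpair : ∀ u v, |dist (y (k u)) (y (k v)) - d * dist (P u) (P v)| ≤ 2 * η * d := by
    intro u v
    have h₂ : (y (k u) - y (k v)) - (d • A (P u) - d • A (P v)) = ((y (k u) - y i) - d • A (P u)) - ((y (k v) - y i) - d • A (P v)) := by abel
    rw [dist_eq_norm, ← hsub]
    calc |‖y (k u) - y (k v)‖ - ‖d • A (P u) - d • A (P v)‖| ≤ ‖(y (k u) - y (k v)) - (d • A (P u) - d • A (P v))‖ := abs_norm_sub_norm_le _ _
      _ = ‖((y (k u) - y i) - d • A (P u)) - ((y (k v) - y i) - d • A (P v))‖ := by rw [h₂]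
      _ ≤ ‖(y (k u) - y i) - d • A (P u)‖ + ‖(y (k v) - y i) - d • A (P v)‖ := norm_sub_le _ _
      _ ≤ η * d + η * d := add_le_add (hfit u) (hfit v)
      _ = 2 * η * d := by ring
  obtain ⟨s, ⟨j₀, rfl⟩, hj₀i, hj₀⟩ := hpin'
  refine ⟨d, η, k, hd, hdD, hη, hkinj, hki, hdist, hpair, hpi, ⟨j₀, fun h => hj₀i (congrArg y h), hj₀⟩, fun j hj hlt => ?_⟩
  have hlt' : dist (y j) (y i) < 13 / 10 * d + γ := by linarith
  obtain ⟨-, ⟨u, hu⟩⟩ := hgap (y j) ⟨j, rfl⟩ (hy.ne hj) hlt'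
  exact ⟨u, hy (by rw [hk u]; exact hu)⟩

/-- The fcc pattern as a `12`-type: cardinality. [cite: HalesDSP2012, §1.3] -/
theorem fcc_card : Fintype.card ↥fccKissingPattern = 12 := (Fintype.card_coe _).trans card_fccKissingPattern

/-- The hcp pattern as a `12`-type: cardinality. [cite: HalesDSP2012, §1.3] -/
theorem hcp_card : Fintype.card ↥hcpKissingPattern = 12 := (Fintype.card_coe _).trans card_hcpKissingPattern

/-- The fcc pattern points are unit vectors. [cite: HalesDSP2012, §1.3] -/
theorem fcc_norm (u : ↥fccKissingPattern) : ‖(u : E3)‖ = 1 := norm_eq_one_of_mem_fccKissingPattern u.2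

/-- The hcp pattern points are unit vectors. [cite: HalesDSP2012, §1.3] -/
theorem hcp_norm (u : ↥hcpKissingPattern) : ‖(u : E3)‖ = 1 := norm_eq_one_of_mem_hcpKissingPattern u.2

/-- The fcc pattern points are pairwise `≥ 1` apart. [cite: HalesDSP2012, §1.3] -/
theorem fcc_sep (u v : ↥fccKissingPattern) (h : u ≠ v) : 1 ≤ dist (u : E3) (v : E3) :=
  one_le_dist_of_mem_fccKissingPattern u.2 v.2 fun h' => h (Subtype.ext h')

/-- The hcp pattern points are pairwise `≥ 1` apart. [cite: HalesDSP2012, §1.3] -/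
theorem hcp_sep (u v : ↥hcpKissingPattern) (h : u ≠ v) : 1 ≤ dist (u : E3) (v : E3) :=
  one_le_dist_of_mem_hcpKissingPattern u.2 v.2 fun h' => h (Subtype.ext h')

/-- **`FewNear z₁ a₁ R n`** — FEWER THAN `n` reference sites other than `a₁` lie within `R` of `z₁ a₁` (an instance-free count, decidable by interval
arithmetic on the reference alone). -/
def FewNear {M₁ : ℕ} (z₁ : Fin M₁ → E3) (a₁ : Fin M₁) (R : ℝ) (n : ℕ) : Prop :=
  ∀ S : Finset (Fin M₁), (∀ b₁ ∈ S, b₁ ≠ a₁ ∧ dist (z₁ b₁) (z₁ a₁) ≤ R) → S.card < n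

/-- `FewNear` is antitone in the radius. [formal bookkeeping] -/
theorem FewNear.anti {M₁ : ℕ} {z₁ : Fin M₁ → E3} {a₁ : Fin M₁} {R R' : ℝ} {n : ℕ} (h : FewNear z₁ a₁ R' n) (hle : R ≤ R') : FewNear z₁ a₁ R n :=
  fun S hS => h S fun b₁ hb₁ => ⟨(hS b₁ hb₁).1, (hS b₁ hb₁).2.trans hle⟩

section Loose
variable {M₁ : ℕ} {z₁ : Fin M₁ → E3} {c₁ a₁ : Fin M₁} {τ : ℝ} {M : ℕ} {z : Fin M → E3} {c : Fin M} {e' : Fin M → Fin M₁}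

/-- (R12) core, one pattern: under an exact-riding chart, a `1/8`-fit at the preimage of `a₁` puts TWELVE distinct reference sites other than `a₁` within
`9/8·(ρ₁ + 2τ) + 2τ` of `z₁ a₁`, where `ρ₁` is the distance from `a₁` to ANY other reference site `s₁` of the `6`-ball (its preimage pins the cluster scale:
`d ≤ ρ₁ + 2τ`), provided the whole shell is inside the `63/10`-ball (room). [folklore] -/
theorem no_fit_of_fewNear {ι : Type*} [Fintype ι] (hcard : Fintype.card ι = 12) (P : ι → E3) (hP1 : ∀ u, ‖P u‖ = 1)
    (hPsep : ∀ u v, u ≠ v → 1 ≤ dist (P u) (P v)) {s₁ : Fin M₁} (hs : s₁ ≠ a₁) (hs₆ : dist (z₁ s₁) (z₁ c₁) ≤ 6)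
    (hroom : dist (z₁ a₁) (z₁ c₁) + 2 * τ + 9 / 8 * (dist (z₁ s₁) (z₁ a₁) + 2 * τ) ≤ 63 / 10)
    (hcount : FewNear z₁ a₁ (9 / 8 * (dist (z₁ s₁) (z₁ a₁) + 2 * τ) + 2 * τ) 12)
    (hch : Charted z₁ c₁ τ 0 0 M z c e') {a : Fin M} (ha : dist (z a) (z c) ≤ 63 / 10) (hea : e' a = a₁)
    (hfit : FitAtScale P (1 / 8) (3 / 2) z a) : False := by
  obtain ⟨d, η, k, hd, -, hη, hkinj, hka, hdist, -, hpin, -, -⟩ := fit_sites P hP1 hPsep (by norm_num) hch.injective hfit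
  obtain ⟨s, hsball, hes⟩ := hch.cover hs₆
  have hsa : s ≠ a := fun h => hs (by rw [← hes, ← hea, h])
  have hρ : d ≤ dist (z₁ s₁) (z₁ a₁) + 2 * τ := by
    have h₁ := hch.dev hsball ha
    rw [hes, hea] at h₁
    have h₂ := hpin s hsa
    linarith [(abs_sub_le_iff.1 h₁).1]
  have hac : dist (z a) (z c) ≤ dist (z₁ a₁) (z₁ c₁) + 2 * τ := by
    have h₁ := hch.centre ha
    rwa [hea] at h₁
  have hshell : ∀ u, dist (z (k u)) (z a) ≤ 9 / 8 * (dist (z₁ s₁) (z₁ a₁) + 2 * τ) := fun u => by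
    have h₁ := (hdist u).2
    nlinarith [mul_lt_mul_of_pos_right hη hd]
  have hball : ∀ u, dist (z (k u)) (z c) ≤ 63 / 10 := fun u => by
    have h₁ := dist_triangle (z (k u)) (z a) (z c)
    linarith [hshell u]
  have himg : ∀ u, e' (k u) ≠ a₁ ∧ dist (z₁ (e' (k u))) (z₁ a₁) ≤ 9 / 8 * (dist (z₁ s₁) (z₁ a₁) + 2 * τ) + 2 * τ := fun u => by
    refine ⟨fun h => hka u (hch.inj (hball u) ha (h.trans hea.symm)), ?_⟩
    have h₁ := hch.dev (hball u) ha
    rw [hea] at h₁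
    linarith [(abs_sub_le_iff.1 h₁).2, hshell u]
  have hinj' : Function.Injective (fun u => e' (k u)) := fun u v h => hkinj (hch.inj (hball u) (hball v) h)
  have h₁ := hcount (Finset.univ.image fun u => e' (k u)) fun b₁ hb₁ => by
    obtain ⟨u, -, rfl⟩ := Finset.mem_image.1 hb₁
    exact himg u
  rw [Finset.card_image_of_injective _ hinj', Finset.card_univ, hcard] at h₁
  exact lt_irrefl _ h₁

/-- ★ **(R12) THE BALL-COUNT BRIDGE (DEAD-hi, LEAF-FREE)**: if some reference site `s₁ ≠ a₁` of the `6`-ball lies within `ρ₁` of `z₁ a₁` and FEWER THAN TWELVE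
reference sites other than `a₁` lie within `9/8·(ρ₁ + 2τ) + 2τ` of `z₁ a₁` (room: `dist (z₁ a₁) (z₁ c₁) + 2τ + 9/8·(ρ₁ + 2τ) ≤ 63/10`), then `a₁` is a LOOSE
WITNESS at exact riding `(τ, 0, 0)`: no cluster site charted onto `a₁` is `1/8`-good (strain of the reference shell above `1/8` by the `2τ` margin, read as a
deficit of sites in the fattened first-shell ball). No rigidity constant is involved. [folklore] -/
theorem looseWitness_of_fewNear {s₁ : Fin M₁} (hs : s₁ ≠ a₁) (hs₆ : dist (z₁ s₁) (z₁ c₁) ≤ 6)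
    (hroom : dist (z₁ a₁) (z₁ c₁) + 2 * τ + 9 / 8 * (dist (z₁ s₁) (z₁ a₁) + 2 * τ) ≤ 63 / 10)
    (hcount : FewNear z₁ a₁ (9 / 8 * (dist (z₁ s₁) (z₁ a₁) + 2 * τ) + 2 * τ) 12) : LooseWitness z₁ c₁ τ 0 0 a₁ := by
  intro M z c e' hch a ha hea hgood
  rcases goodAtScale_iff_fcc_or_hcp.1 hgood with h | h
  · exact no_fit_of_fewNear fcc_card (fun u : ↥fccKissingPattern => (u : E3)) fcc_norm fcc_sep hs hs₆ hroom hcount hch ha hea h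
  · exact no_fit_of_fewNear hcp_card (fun u : ↥hcpKissingPattern => (u : E3)) hcp_norm hcp_sep hs hs₆ hroom hcount hch ha hea h

/-- ★ (R12) ⟹ DEAD cell. [folklore] -/
theorem deadRef_of_fewNear {s₁ : Fin M₁} (ha₁ : dist (z₁ a₁) (z₁ c₁) ≤ 6) (hs : s₁ ≠ a₁) (hs₆ : dist (z₁ s₁) (z₁ c₁) ≤ 6)
    (hroom : dist (z₁ a₁) (z₁ c₁) + 2 * τ + 9 / 8 * (dist (z₁ s₁) (z₁ a₁) + 2 * τ) ≤ 63 / 10)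
    (hcount : FewNear z₁ a₁ (9 / 8 * (dist (z₁ s₁) (z₁ a₁) + 2 * τ) + 2 * τ) 12) : DeadRef z₁ c₁ τ 0 0 :=
  deadRef_of_looseWitness ha₁ (looseWitness_of_fewNear hs hs₆ hroom hcount)

/-- (N13) core, one pattern: under an exact-riding chart, a `1/8`-fit at the preimage of `a₁` (scale `d ≥ m₁ − 2τ`, `m₁` = a lower bound for the distances from
`a₁` to the other reference sites, read through the image of the cluster's nearest neighbour) leaves room for AT MOST TWELVE reference sites other than `a₁`
within any `R` with `R + 2τ < 13/10·(m₁ − 2τ)` (their preimages fall in the clean gap, hence among the twelve fitted sites). [folklore] -/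
theorem no_fit_of_crowd {ι : Type*} [Fintype ι] (hcard : Fintype.card ι = 12) (P : ι → E3) (hP1 : ∀ u, ‖P u‖ = 1)
    (hPsep : ∀ u v, u ≠ v → 1 ≤ dist (P u) (P v)) {m₁ R : ℝ} (hm : ∀ b₁, b₁ ≠ a₁ → m₁ ≤ dist (z₁ b₁) (z₁ a₁))
    (hroom : dist (z₁ a₁) (z₁ c₁) + 2 * τ + 3 / 2 ≤ 63 / 10) (hroom' : dist (z₁ a₁) (z₁ c₁) + R ≤ 6) (hR : R + 2 * τ < 13 / 10 * (m₁ - 2 * τ))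
    (S : Finset (Fin M₁)) (hS : 12 < S.card) (hSa : ∀ b₁ ∈ S, b₁ ≠ a₁ ∧ dist (z₁ b₁) (z₁ a₁) ≤ R)
    (hch : Charted z₁ c₁ τ 0 0 M z c e') {a : Fin M} (ha : dist (z a) (z c) ≤ 63 / 10) (hea : e' a = a₁)
    (hfit : FitAtScale P (1 / 8) (3 / 2) z a) : False := by
  obtain ⟨d, η, k, hd, hdD, -, -, -, -, -, -, ⟨j₀, hj₀a, hj₀⟩, hgap⟩ := fit_sites P hP1 hPsep (by norm_num) hch.injective hfit
  have hac : dist (z a) (z c) ≤ dist (z₁ a₁) (z₁ c₁) + 2 * τ := by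
    have h₁ := hch.centre ha
    rwa [hea] at h₁
  have hj₀ball : dist (z j₀) (z c) ≤ 63 / 10 := by
    have h₁ := dist_triangle (z j₀) (z a) (z c)
    linarith
  have hdm : m₁ - 2 * τ ≤ d := by
    have h₁ := hch.dev hj₀ball ha
    rw [hea] at h₁
    have h₂ := hm (e' j₀) fun h => hj₀a (hch.inj hj₀ball ha (h.trans hea.symm))
    linarith [(abs_sub_le_iff.1 h₁).2]
  have hpre : ∀ b₁ ∈ S, ∃ u, e' (k u) = b₁ := by
    intro b₁ hb₁
    obtain ⟨hb₁a, hb₁R⟩ := hSa b₁ hb₁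
    have hb₁6 : dist (z₁ b₁) (z₁ c₁) ≤ 6 := by
      have h₁ := dist_triangle (z₁ b₁) (z₁ a₁) (z₁ c₁)
      linarith
    obtain ⟨j, hjball, hej⟩ := hch.cover hb₁6
    have hja : j ≠ a := fun h => hb₁a (by rw [← hej, h, hea])
    have h₁ := hch.dev hjball ha
    rw [hej, hea] at h₁
    have hlt : dist (z j) (z a) < 13 / 10 * d := by
      linarith [(abs_sub_le_iff.1 h₁).1]
    obtain ⟨u, hu⟩ := hgap j hja hlt
    exact ⟨u, by rw [hu, hej]⟩
  have hsub : S ⊆ Finset.univ.image fun u => e' (k u) := fun b₁ hb₁ => by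
    obtain ⟨u, hu⟩ := hpre b₁ hb₁
    exact Finset.mem_image.2 ⟨u, Finset.mem_univ _, hu⟩
  have h₁ := Finset.card_le_card hsub
  have h₂ : (Finset.univ.image fun u => e' (k u)).card ≤ 12 :=
    Finset.card_image_le.trans (by rw [Finset.card_univ, hcard])
  omega

/-- ★ **(N13) THE THIRTEENTH-NEIGHBOUR BRIDGE (DEAD-hi, LEAF-FREE)**: if every reference site other than `a₁` is at distance `≥ m₁` from `z₁ a₁` and THIRTEEN or
more reference sites other than `a₁` lie within `R` of it, `R + 2τ < 13/10·(m₁ − 2τ)` (room: `dist (z₁ a₁) (z₁ c₁) + 2τ + 3/2 ≤ 63/10` and `+ R ≤ 6`), then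
`a₁` is a LOOSE WITNESS at exact riding: the clean gap below `13/10·d` of a `1/8`-good site holds only twelve sites. No rigidity constant. [folklore] -/
theorem looseWitness_of_crowd {m₁ R : ℝ} (hm : ∀ b₁, b₁ ≠ a₁ → m₁ ≤ dist (z₁ b₁) (z₁ a₁))
    (hroom : dist (z₁ a₁) (z₁ c₁) + 2 * τ + 3 / 2 ≤ 63 / 10) (hroom' : dist (z₁ a₁) (z₁ c₁) + R ≤ 6) (hR : R + 2 * τ < 13 / 10 * (m₁ - 2 * τ))
    (S : Finset (Fin M₁)) (hS : 12 < S.card) (hSa : ∀ b₁ ∈ S, b₁ ≠ a₁ ∧ dist (z₁ b₁) (z₁ a₁) ≤ R) : LooseWitness z₁ c₁ τ 0 0 a₁ := by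
  intro M z c e' hch a ha hea hgood
  rcases goodAtScale_iff_fcc_or_hcp.1 hgood with h | h
  · exact no_fit_of_crowd fcc_card (fun u : ↥fccKissingPattern => (u : E3)) fcc_norm fcc_sep hm hroom hroom' hR S hS hSa hch ha hea h
  · exact no_fit_of_crowd hcp_card (fun u : ↥hcpKissingPattern => (u : E3)) hcp_norm hcp_sep hm hroom hroom' hR S hS hSa hch ha hea h

/-- ★ (N13) ⟹ DEAD cell. [folklore] -/
theorem deadRef_of_crowd {m₁ R : ℝ} (ha₁ : dist (z₁ a₁) (z₁ c₁) ≤ 6) (hm : ∀ b₁, b₁ ≠ a₁ → m₁ ≤ dist (z₁ b₁) (z₁ a₁))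
    (hroom : dist (z₁ a₁) (z₁ c₁) + 2 * τ + 3 / 2 ≤ 63 / 10) (hroom' : dist (z₁ a₁) (z₁ c₁) + R ≤ 6) (hR : R + 2 * τ < 13 / 10 * (m₁ - 2 * τ))
    (S : Finset (Fin M₁)) (hS : 12 < S.card) (hSa : ∀ b₁ ∈ S, b₁ ≠ a₁ ∧ dist (z₁ b₁) (z₁ a₁) ≤ R) : DeadRef z₁ c₁ τ 0 0 :=
  deadRef_of_looseWitness ha₁ (looseWitness_of_crowd hm hroom hroom' hR S hS hSa)

end Loose

end Summit.AtomisticToContinuum.Crystallization.Theorems.FrustratedLawDichotomyStrainedPatchShellWitness
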